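import Literature.MathematicalPhysics.QuantumFieldTheory.Balaban1983to89.B12WardSecond415

/-!
# Bałaban CMP 109 (1987) §4 p. 289: the SCHUR STEP after (4.32)–(4.33) «the identity (4.33) holds for 𝐄 if and
only if 𝐄_ab is proportional to the identity matrix, 𝐄_ab = 𝐄δ_ab, and then ⟨𝐄, A⊗B⟩ = 𝐄 tr AB» — TRUE for `𝔤`
with scalar centroid (simple `G`; kernel-discharged over `ℂ` and for compact simple `G`), FALSE under print's
standing hypothesis «G is semisimple» alone (product algebras); typed hypothesis for objection G-adv2-1

CITATION HEADER (lean-in-tree rule 2026-08-18).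
* Source: T. Bałaban, "Renormalization group approach to lattice gauge field theories. I. Generation of effective
  actions in a small field approximation and a coupling constant renormalization in four dimensions", Commun. Math.
  Phys. **109** (1987) 249–301, doi:10.1007/bf01215223 [Balaban1987RG1] (cell paper B12; held:
  `paper:balaban1987-cmp109-rg-i-small-field`; PDF page = journal page − 248), pp. 251–252 (standing hypothesis on
  `G`), p. 259 (scope sentence before Theorem 2), p. 289, displays (4.32)–(4.34).  The sentences quoted below were READ
  AS IMAGES by the author of this file on the 300-dpi renders of the audit cell (`HOME/b2b-balaban-ref1/pages/
  1987-cmp109-rg-I-small-field/…-p003-x2.png` = p. 251, `…-p004-x2.png` = p. 252, `…-p011-x2.png` = p. 259,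
  `…-p041-x2.png` = p. 289; HOME = the cell folder `run/shared/lean/pub/pub-balaban/`) and agree with the lineage
  transcript `HOME/b2b-balaban-b03/B12s-transcript.md`; inside quotation marks nothing is altered.  Audit cell
  `pub-balaban`, unit `b2b-balaban-b03-g23` (PAPER SUB-CELL B03 → B12 §§2–5 lineage, gen 23), node B12-SCHUR-433.
  Imports only the lineage's own accepted module `…B12WardSecond415` (gen 22: `hessian_chart_ad_invariant`, the
  infinitesimal form of (4.33) derived from (4.7); through it `…B12Semisimple414` (gen 21: the chart calculus,
  `chart_zero`, `contDiff_chart`, `exists_rho_eq_commutator`, `span_commutatorSet_eq_top_of_isSemisimple`) and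
  Mathlib's Lie-algebra library: `LinearMap.BilinForm.lieInvariant`, `killingForm`, `LieAlgebra.IsSimple`,
  `LieAlgebra.IsKilling`, `LieAlgebra.Prod`, `Module.End.exists_eigenvalue`, `minpoly`,
  `Irreducible.natDegree_le_two`); modifies nothing.
* Statements reproduced (verbatim).  pp. 251–252 [PDF 3–4]: *"Field configurations have values in a compact Lie group
  G. For definitions concerning Lie groups and algebras see [71]. We assume that G is semisimple and that it is a Lie
  subgroup of a group of complex unitary matrices, for example G ⊂ U(N). (In fact a bigger part of our considerations
  does not depend on the semisimplicity assumption.)"* ([71] = p. 301: *"Varadarajan, V.S.: Lie groups, Lie algebras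
  and their representations. New York: Prentice-Hall 1974"*).  p. 259 [PDF 11]: *"It will be proved in this paper for
  an arbitrary semisimple compact Lie group G ⊂ U(N), and for d = 4."* and *"Theorem 2. Let d = 4, G = SU(2), […]"*.
  p. 289 [PDF 41]: *"The basic identity (4.9) holds for all gauge transformations, hence for constant transformations
  it is 𝐄(exp iR(v)B) = 𝐄(exp iB), and it implies"* (4.32) *"⟨𝐄^{(2)}, R(v)B, R(v)B⟩ = ⟨𝐄^{(2)}, B, B⟩, v ∈ G."*
  *"The corresponding function 𝐄^{(2)}_{μ,ν}(x, y) has values in the tensor product 𝔤⊗𝔤, and the above identity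
  implies"* (4.33) *"R(v)⊗R(v)𝐄^{(2)}_{μ,ν}(x, y) = 𝐄^{(2)}_{μ,ν}(x, y), v ∈ G."* *"The infinitesimal form of this
  identity is a consequence of (4.11), or the second identity in (4.15). An element 𝐄 in 𝔤⊗𝔤 can be identified with
  the matrix 𝐄_ab of components in the basis {τ_a⊗τ_b}, τ_a are generators of the algebra 𝔤, or with the bilinear
  form ⟨𝐄, A⊗B⟩ on 𝔤. With our assumptions on the group G the identity (4.33) holds for 𝐄 if and only if 𝐄_ab is
  proportional to the identity matrix, 𝐄_ab = 𝐄δ_ab, and then ⟨𝐄, A⊗B⟩ = 𝐄 tr AB. This gives a further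
  simplification of the expressions in (4.29), (4.31). Let us write the result of the preceding analysis"* (4.34), first
  line: *"(4.6) = Σ_{(x,μ),(y,ν)} 𝐄^{(2)}_{μ,ν}(X, x, y) tr δB_μ(x)B_ν(y) + […]"*.  (Inside quotation marks `[…]` marks
  an omission by the author of this file.)
* Dictionary print → Lean (the only modelling choices; all algebra / bookkeeping, no analysis).  Print's «element 𝐄
  in 𝔤⊗𝔤 … or … the bilinear form ⟨𝐄, A⊗B⟩ on 𝔤» ↦ a bilinear form `Φ : LinearMap.BilinForm K 𝔤` (or an `F`-valued
  bilinear map `H : 𝔤 →ₗ[K] 𝔤 →ₗ[K] F`, print's 𝐄 being complex-valued); «the identity (4.33) holds for 𝐄» in its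
  infinitesimal form (print: «The infinitesimal form of this identity …») ↦ Mathlib's `Φ.lieInvariant 𝔤`, i.e.
  `Φ ⁅x, y⁆ z = −Φ y ⁅x, z⁆`; «tr AB» ↦ a fixed NONDEGENERATE INVARIANT form `β` on `𝔤` (the trace form of the
  defining representation `𝔤 ⊂ 𝔲(N)`, or the Killing form `killingForm K 𝔤` — by the theorem itself all such `β` are
  proportional when the centroid is scalar); «𝐄_ab = 𝐄δ_ab … ⟨𝐄, A⊗B⟩ = 𝐄 tr AB» ↦ `∃ c, ∀ x y, Φ x y = c * β x y`
  (basis-free; print's `δ_ab` presupposes generators `τ_a` orthonormal for `tr`).  «our assumptions on the group G» =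
  pp. 251–252: `G` compact, SEMISIMPLE, `G ⊂ U(N)`; in Lean: `LieAlgebra.IsSemisimple` / `LieAlgebra.IsKilling` (print's
  hypothesis), `LieAlgebra.IsSimple` + `IsAlgClosed K` (print's `𝔤^c` for simple `G`) or `LieAlgebra.IsSimple ℝ 𝔤` +
  NEGATIVE DEFINITE Killing form (compact simple `G`), and the NAMED HYPOTHESIS that makes the sentence true in
  general — SCALAR CENTROID `hcen : ∀ φ : 𝔤 →ₗ[K] 𝔤, (∀ x y, φ ⁅x, y⁆ = ⁅x, φ y⁆) → ∃ c, ∀ x, φ x = c • x` (every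
  endomorphism commuting with all `ad_x` is a scalar; for semisimple `𝔤` this says: `𝔤` is simple with centroid `K`).
  §4 is typed EXACTLY over the parent's dictionary (`…B12WardSecond415` / `…B12Semisimple414`): the chart functional
  `f(B) = ℰ(exp ρB)` of `𝔤`-valued fields `B : Λ → T → V`, `eV : V ≃ₗ[ℝ] 𝔤`, `ρ : V →L[ℝ] 𝔄` intertwining brackets
  and commutators (`hρ`), `ℰ` `C³` at `1`, (4.7) as the ambient flow hypothesis `h47`; print's kernel
  `𝐄^{(2)}_{μ,ν}(X, x, y)` ↦ the bond-pair entries of the Hessian `D²f(0)` on one-bond fields `Pi.single μ (Pi.single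
  x a)`.  The module is DEFINITION-FREE.
* The mathematics.  (i) [folklore, Schur/Riesz] `Φ` invariant, `β` invariant nondegenerate on finite-dimensional `𝔤`:
  the endomorphism `A = β♯⁻¹ ∘ Φ♭` (`β (A x) y = Φ x y`, Mathlib's `LinearMap.BilinForm.toDual`) commutes with every
  `ad_x`; under SCALAR CENTROID `A = c·1`, i.e. `Φ = c·β` — print's sentence; vector-valued `H` by composing with the
  dual of `F` (`Module.forall_dual_apply_eq_zero_iff`).  (ii) Scalar centroid HOLDS for `𝔤` simple over an
  algebraically closed field (an eigenspace of a centroid element is a nonzero ideal; `Module.End.exists_eigenvalue`,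
  `LieAlgebra.IsSimple.eq_bot_or_eq_top`) and for `𝔤` simple over `ℝ` with negative definite Killing form (compact
  simple `G`): a centroid element `φ` is `κ`-symmetric (`ad_{φx} ad_y = ad_x ad_{φy}` as endomorphisms); an irreducible
  factor `q` of its minimal polynomial has degree `≤ 2` (`Irreducible.natDegree_le_two`) and a nonzero kernel
  `ker q(φ)`, an ideal, hence `q(φ) = 0`; degree `1` gives `φ = c·1`, degree `2` (no real root, discriminant `< 0`)
  gives `κ((2q₂φ + q₁)x, (2q₂φ + q₁)x) = (q₁² − 4q₂q₀)·κ(x, x) > 0` for `x ≠ 0`, contradicting definiteness.  (iii)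
  Scalar centroid — hence print's sentence — FAILS for a product `𝔤₁ × 𝔤₂` of nonzero algebras (print's «semisimple»
  admits `G = SU(2) × SU(2) ⊂ U(4)`, `𝔤 = 𝔰𝔲(2) ⊕ 𝔰𝔲(2)`): the projection `(x₁, x₂) ↦ (x₁, 0)` commutes with `ad` and
  is not a scalar, and the pullback `Φ((x₁,x₂),(y₁,y₂)) = Φ₁(x₁,y₁)` of a nonzero invariant form of `𝔤₁` is invariant,
  nonzero and degenerate, hence `≠ c·β` for EVERY nondegenerate `β` (in coordinates: `𝐄_ab` is block-scalar
  `diag(𝐄′·1, 𝐄″·1)`, not `𝐄δ_ab`).  (iv) In the lineage's typing: by the parent's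
  `hessian_chart_ad_invariant_of_isSemisimple` and the symmetry of second derivatives (`ContDiffAt.isSymmSndFDerivAt`)
  every bond-pair entry of `D²f(0)` is an invariant `F`-valued bilinear map on `𝔤`, so under scalar centroid
  `D²f(0)(u, v) = Σ_{μ,x,ν,y} β(u_μ(x), v_ν(y)) • E_{μν}(x,y)` with a SCALAR kernel `E : Λ → T → Λ → T → F` — the shape
  of (4.34), line 1.

WHAT IS PROVED (kernel-checked, no `sorry`, standard axioms, NO definitions; every analytic input a NAMED HYPOTHESIS):
* §1 [folklore] `lie_apply_eq_apply_lie` (a centroid element commutes with `ad` on both sides);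
  `exists_eq_mul_of_lieInvariant` — **the p. 289 sentence under SCALAR CENTROID**: `Φ` invariant ⇒ `∃ c, Φ = c·β`;
  `exists_eq_smul_of_lieInvariant₂` (the same for `F`-valued invariant bilinear maps: `H x y = β x y • c`).
* §2 [folklore] `nontrivial_of_isSimple`; `exists_eq_smul_of_centroid_of_isAlgClosed` — scalar centroid for `𝔤`
  SIMPLE over an algebraically closed field (print's `𝔤^c`, `G` simple); `killing_apply_centroid` (`κ(φx, y) = κ(x, φy)`);
  `exists_eq_smul_of_centroid_of_killing_neg` — scalar centroid for `𝔤` SIMPLE over `ℝ` with negative definite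
  Killing form (compact simple `G`, e.g. Theorem 2's `SU(2)`); corollaries `exists_eq_mul_killingForm_of_isAlgClosed`,
  `exists_eq_mul_killingForm_of_killing_neg` (every invariant form is `c·κ`).
* §3 REFUTATION UNDER «SEMISIMPLE» ALONE [folklore]: on `𝔤₁ × 𝔤₂` (Mathlib's `LieAlgebra.Prod`),
  `fstProj_lie_comm` + `not_exists_fstProj_eq_smul` (the centroid is not scalar when both factors are nonzero),
  `pullbackFst_lieInvariant`, `pullbackFst_ne_zero`, `not_exists_pullbackFst_eq_mul` (an invariant nonzero form that is
  NOT `c·β` for any nondegenerate `β` as soon as `𝔤₂ ≠ 0`) — so the conclusion of §1 and the hypothesis `hcen` both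
  fail for every product of two nonzero (e.g. simple) Lie algebras, which print's pp. 251–252 / p. 259 hypothesis
  «semisimple compact Lie group G ⊂ U(N)» admits.  Theorem 2 (`G = SU(2)`, simple) is unaffected.
* §4 (lineage capstone) `hessian_chart_symm` (Schwarz: `D²f(0)` is symmetric, `ContDiffAt.isSymmSndFDerivAt`);
  `hessian_chart_single_lieInvariant` — each bond-pair entry `(a, b) ↦ D²f(0)(δ_{μ,x}a,
  δ_{ν,y}b)` is an invariant bilinear map (from (4.7) via the parent, `G` semisimple, `ℰ` `C³` at `1`);
  `hessian_chart_eq_sum_scalar_kernel` — **(4.34), line 1, under SCALAR CENTROID**: `∃ E, ∀ u v, D²f(0)(u, v) =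
  Σ_{μ,x,ν,y} β(eV(u_μ(x)), eV(v_ν(y))) • E μ x ν y`; `hessian_chart_eq_sum_scalar_kernel_killing` (the same with
  `β = κ`, `LieAlgebra.IsKilling ℝ 𝔤` + `hcen`).

WHAT IS NOT PROVED HERE (and not claimed): that a compact simple `G ⊂ U(N)` has negative definite Killing form, or
that `𝔤^c` is simple for compact simple `G` (classical Lie theory, print's [71]; they enter §2 as the hypotheses
`hdef` / `IsAlgClosed` + `IsSimple`, never as facts); the finite (group) form (4.32)/(4.33) (print's `R(v)`, `𝐄^{(2)}`
as functions of the block variable `X` are not modelled — only the infinitesimal form, as in the parent); the «if»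
direction of print's «if and only if» beyond the tautology that `c·β` is invariant; the simplification of (4.29),
(4.31) and lines 2–4 of (4.34); anything analytic (existence / analyticity of `𝐄^{(2)}`), B13, the continuum limit.

HONEST FRAMING: value = a TYPED HYPOTHESIS for an already-filed prose objection of the audit cell (GAPS.md G-adv2-1,
2026-08-18: the p. 289 Schur sentence is false as stated for semisimple non-simple `G` and true for simple `G`;
concurred C-adv9-14 (a); typed hypothesis requested G-tmpl11-2 (a)): the kernel now certifies BOTH halves — §3 the
counterexample family under print's stated standing hypothesis, §§1–2 the sentence under the named hypothesis SCALAR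
CENTROID with its two classical discharges (simple `𝔤^c`; compact simple `G`) — and §4 carries it into the lineage's
own (4.7)-setting.  The one-line repair of print is «G simple» in place of «G semisimple» on pp. 251/259 for §4 from
(4.32) on (Theorem 2's `SU(2)` satisfies it).  NOT summit progress: Lie-algebra bookkeeping around a printed sentence;
every analytic statement remains a hypothesis.
-/


namespace Literature.MathematicalPhysics.QuantumFieldTheory.Balaban1983to89.B12Schur433

open Literature.MathematicalPhysics.QuantumFieldTheory.Balaban1983to89.B12WardSecond415
  (hessian_chart_ad_invariant_of_isSemisimple)
open Literature.MathematicalPhysics.QuantumFieldTheory.Balaban1983to89.B12Semisimple414 (chart_zero contDiff_chart)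
open NormedSpace (exp)
open Filter
open _root_.Topology

/-! ## §1. Invariant bilinear forms under scalar centroid: the p. 289 sentence [folklore] -/

section Schur

variable {K : Type*} [Field K] {𝔤 : Type*} [LieRing 𝔤] [LieAlgebra K 𝔤]

/-- A centroid element (`φ ⁅x, y⁆ = ⁅x, φ y⁆`) also satisfies `⁅φ x, y⁆ = φ ⁅x, y⁆`. [folklore] -/
theorem lie_apply_eq_apply_lie (φ : 𝔤 →ₗ[K] 𝔤) (hφ : ∀ x y : 𝔤, φ ⁅x, y⁆ = ⁅x, φ y⁆) (x y : 𝔤) :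
    ⁅φ x, y⁆ = φ ⁅x, y⁆ :=
  calc ⁅φ x, y⁆ = -⁅y, φ x⁆ := (lie_skew _ _).symm
    _ = -(φ ⁅y, x⁆) := by rw [hφ]
    _ = φ (-⁅y, x⁆) := (map_neg φ _).symm
    _ = φ ⁅x, y⁆ := by rw [lie_skew]

/-- **p. 289 «With our assumptions on the group G the identity (4.33) holds for 𝐄 if and only if 𝐄_ab is
proportional to the identity matrix, 𝐄_ab = 𝐄δ_ab, and then ⟨𝐄, A⊗B⟩ = 𝐄 tr AB»** — under the NAMED hypothesis
SCALAR CENTROID (`hcen`; it holds for simple `G`, §2, and fails for semisimple non-simple `G`, §3): on a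
finite-dimensional Lie algebra carrying a nondegenerate invariant form `β` (print's `tr AB`), every invariant bilinear
form `Φ` (print's 𝐄 ∈ 𝔤⊗𝔤 satisfying the infinitesimal (4.33)) is `c·β`.  Proof: the `β`-Riesz representative
`A` of `Φ` (`β (A x) y = Φ x y`) commutes with `ad`, hence is a scalar. [folklore] (print: Balaban1987RG1, p.289 after
(4.33)) -/
theorem exists_eq_mul_of_lieInvariant [FiniteDimensional K 𝔤] (β Φ : LinearMap.BilinForm K 𝔤)
    (hβ : β.lieInvariant 𝔤) (hβn : β.Nondegenerate)
    (hcen : ∀ φ : 𝔤 →ₗ[K] 𝔤, (∀ x y : 𝔤, φ ⁅x, y⁆ = ⁅x, φ y⁆) → ∃ c : K, ∀ x, φ x = c • x)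
    (hΦ : Φ.lieInvariant 𝔤) : ∃ c : K, ∀ x y : 𝔤, Φ x y = c * β x y := by
  -- Riesz: `Φ x = β (A x)`
  let A : 𝔤 →ₗ[K] 𝔤 := (β.toDual hβn).symm.toLinearMap ∘ₗ Φ
  have hA : ∀ x y, β (A x) y = Φ x y := fun x y =>
    LinearMap.BilinForm.apply_toDual_symm_apply (hB := hβn) (Φ x) y
  -- `A` commutes with `ad`
  have hAc : ∀ x y : 𝔤, A ⁅x, y⁆ = ⁅x, A y⁆ := by
    intro x y
    rw [← sub_eq_zero]
    refine hβn.1 _ (fun z => ?_)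
    rw [map_sub, LinearMap.sub_apply, hA, hΦ x y z, hβ x (A y) z, hA, sub_self]
  obtain ⟨c, hc⟩ := hcen A hAc
  refine ⟨c, fun x y => ?_⟩
  rw [← hA x y, hc x, map_smul, LinearMap.smul_apply, smul_eq_mul]

/-- Vector-valued version of `exists_eq_mul_of_lieInvariant` (print's 𝐄 is complex-valued; the lineage's `ℰ` takes
values in a normed space `F`): an invariant bilinear map `H : 𝔤 × 𝔤 → F` is `β ⊗ c` for one vector `c ∈ F`, under
scalar centroid. [folklore] (print: Balaban1987RG1, p.289 after (4.33)) -/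
theorem exists_eq_smul_of_lieInvariant₂ [FiniteDimensional K 𝔤] {F : Type*} [AddCommGroup F] [Module K F]
    (β : LinearMap.BilinForm K 𝔤) (hβ : β.lieInvariant 𝔤) (hβn : β.Nondegenerate)
    (hcen : ∀ φ : 𝔤 →ₗ[K] 𝔤, (∀ x y : 𝔤, φ ⁅x, y⁆ = ⁅x, φ y⁆) → ∃ c : K, ∀ x, φ x = c • x)
    (H : 𝔤 →ₗ[K] 𝔤 →ₗ[K] F) (hH : ∀ x y z : 𝔤, H ⁅x, y⁆ z = -H y ⁅x, z⁆) :
    ∃ c : F, ∀ x y : 𝔤, H x y = β x y • c := by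
  -- every scalar component `ℓ ∘ H` is an invariant form, hence `c_ℓ · β`
  have hℓ : ∀ ℓ : Module.Dual K F, ∃ cℓ : K, ∀ x y, ℓ (H x y) = cℓ * β x y := by
    intro ℓ
    have h := exists_eq_mul_of_lieInvariant β (H.compr₂ ℓ) hβ hβn hcen (fun x y z => by
      simp only [LinearMap.compr₂_apply, hH x y z, map_neg])
    simpa only [LinearMap.compr₂_apply] using h
  by_cases h0 : ∀ x y : 𝔤, β x y = 0
  · -- `β = 0` nondegenerate forces `𝔤 = 0`
    refine ⟨0, fun x y => ?_⟩
    have hx : x = 0 := hβn.1 x (fun y => h0 x y)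
    simp [hx]
  · push Not at h0
    obtain ⟨x₀, y₀, hxy⟩ := h0
    -- normalise: `β x₁ y₀ = 1`
    have h1 : β ((β x₀ y₀)⁻¹ • x₀) y₀ = 1 := by
      rw [map_smul, LinearMap.smul_apply, smul_eq_mul, inv_mul_cancel₀ hxy]
    refine ⟨H ((β x₀ y₀)⁻¹ • x₀) y₀, fun x y => ?_⟩
    rw [← sub_eq_zero]
    refine (Module.forall_dual_apply_eq_zero_iff K _).mp (fun ℓ => ?_)
    obtain ⟨cℓ, hcℓ⟩ := hℓ ℓ
    rw [map_sub, map_smul, hcℓ, hcℓ, h1, mul_one, smul_eq_mul, mul_comm, sub_self]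

end Schur

/-! ## §2. Discharging scalar centroid: simple `𝔤` over an algebraically closed field; compact simple `G` [folklore] -/

section Centroid

variable {K : Type*} [Field K] {𝔤 : Type*} [LieRing 𝔤] [LieAlgebra K 𝔤]

variable (K 𝔤) in
/-- A simple Lie algebra is nontrivial. [folklore] -/
theorem nontrivial_of_isSimple [LieAlgebra.IsSimple K 𝔤] : Nontrivial 𝔤 := by
  by_contra h
  haveI : Subsingleton 𝔤 := not_nontrivial_iff_subsingleton.mp h
  exact LieAlgebra.not_isSimple_of_subsingleton K 𝔤 inferInstance

/-- **Scalar centroid for `𝔤` SIMPLE over an ALGEBRAICALLY CLOSED field** (print's complexified algebra `𝔤^c` for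
simple `G`; `𝔰𝔩(2, ℂ)` for Theorem 2's `SU(2)`): an endomorphism commuting with every `ad_x` is a scalar.  Proof:
an eigenspace (`Module.End.exists_eigenvalue`) is a nonzero ideal, hence everything. [folklore] -/
theorem exists_eq_smul_of_centroid_of_isAlgClosed [IsAlgClosed K] [FiniteDimensional K 𝔤] [LieAlgebra.IsSimple K 𝔤]
    (φ : 𝔤 →ₗ[K] 𝔤) (hφ : ∀ x y : 𝔤, φ ⁅x, y⁆ = ⁅x, φ y⁆) : ∃ c : K, ∀ x, φ x = c • x := by
  haveI : Nontrivial 𝔤 := nontrivial_of_isSimple K 𝔤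
  obtain ⟨c, hc⟩ := Module.End.exists_eigenvalue φ
  let I : LieIdeal K 𝔤 :=
    { Module.End.eigenspace φ c with
      lie_mem := fun {x m} (hm : m ∈ Module.End.eigenspace φ c) =>
        show ⁅x, m⁆ ∈ Module.End.eigenspace φ c from by
          have hm' : φ m = c • m := Module.End.mem_eigenspace_iff.mp hm
          exact Module.End.mem_eigenspace_iff.mpr (by rw [hφ, hm', lie_smul]) }
  rcases LieAlgebra.IsSimple.eq_bot_or_eq_top I with h | h
  · have hb : Module.End.eigenspace φ c = ⊥ := (LieSubmodule.toSubmodule_eq_bot I).mpr h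
    exact absurd hb (Module.End.hasEigenvalue_iff.mp hc)
  · refine ⟨c, fun x => ?_⟩
    have hx : x ∈ I := by
      rw [h]
      exact LieSubmodule.mem_top x
    exact Module.End.mem_eigenspace_iff.mp hx

/-- Every invariant bilinear form on a simple Lie algebra with nondegenerate Killing form over an algebraically
closed field is a multiple of the Killing form (print's sentence for `𝔤^c`, `G` simple). [folklore]
(print: Balaban1987RG1, p.289 after (4.33)) -/
theorem exists_eq_mul_killingForm_of_isAlgClosed [IsAlgClosed K] [FiniteDimensional K 𝔤]
    [LieAlgebra.IsSimple K 𝔤] [LieAlgebra.IsKilling K 𝔤] (Φ : LinearMap.BilinForm K 𝔤) (hΦ : Φ.lieInvariant 𝔤) :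
    ∃ c : K, ∀ x y : 𝔤, Φ x y = c * killingForm K 𝔤 x y :=
  exists_eq_mul_of_lieInvariant (killingForm K 𝔤) Φ (LieModule.traceForm_lieInvariant K 𝔤 𝔤)
    (LieAlgebra.IsKilling.killingForm_nondegenerate K 𝔤) (exists_eq_smul_of_centroid_of_isAlgClosed) hΦ

/-- A centroid element is symmetric for the Killing form: `κ(φx, y) = κ(x, φy)` (indeed `ad_{φx} ∘ ad_y = ad_x ∘
ad_{φy}` as endomorphisms). [folklore] -/
theorem killing_apply_centroid (φ : 𝔤 →ₗ[K] 𝔤) (hφ : ∀ x y : 𝔤, φ ⁅x, y⁆ = ⁅x, φ y⁆) (x y : 𝔤) :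
    killingForm K 𝔤 (φ x) y = killingForm K 𝔤 x (φ y) := by
  rw [killingForm_apply_apply, killingForm_apply_apply]
  congr 1
  ext z
  simp only [LinearMap.coe_comp, Function.comp_apply, LieAlgebra.ad_apply]
  rw [lie_apply_eq_apply_lie φ hφ, lie_apply_eq_apply_lie φ hφ, hφ]

/-- **Scalar centroid for `𝔤` SIMPLE over `ℝ` with NEGATIVE DEFINITE Killing form** (the Lie algebra of a compact
simple `G ⊂ U(N)` — print's standing hypothesis with «semisimple» sharpened to «simple»; e.g. Theorem 2's `SU(2)`).
Proof: a centroid element `φ` is `κ`-symmetric; an irreducible factor `q` of its minimal polynomial has degree `≤ 2`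
(`Irreducible.natDegree_le_two`) and `ker q(φ) ≠ 0` is an ideal, so `q(φ) = 0`; degree `1` ⇒ `φ` scalar; degree `2`
⇒ `q` has no real root and `κ((2q₂φ + q₁)x, (2q₂φ + q₁)x) = (q₁² − 4q₂q₀)κ(x, x) > 0` for `x ≠ 0`, impossible.
[folklore] -/
theorem exists_eq_smul_of_centroid_of_killing_neg {𝔤 : Type*} [LieRing 𝔤] [LieAlgebra ℝ 𝔤] [FiniteDimensional ℝ 𝔤]
    [LieAlgebra.IsSimple ℝ 𝔤] (hdef : ∀ x : 𝔤, x ≠ 0 → killingForm ℝ 𝔤 x x < 0)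
    (φ : 𝔤 →ₗ[ℝ] 𝔤) (hφ : ∀ x y : 𝔤, φ ⁅x, y⁆ = ⁅x, φ y⁆) : ∃ c : ℝ, ∀ x, φ x = c • x := by
  classical
  haveI : Nontrivial 𝔤 := nontrivial_of_isSimple ℝ 𝔤
  have hle : ∀ w : 𝔤, killingForm ℝ 𝔤 w w ≤ 0 := fun w => by
    rcases eq_or_ne w 0 with rfl | hw
    · simp
    · exact (hdef w hw).le
  -- an irreducible factor `q` of the minimal polynomial, of degree 1 or 2
  have hint : IsIntegral ℝ φ := LinearMap.isIntegral φ
  obtain ⟨q, hq, hqp⟩ := WfDvdMonoid.exists_irreducible_factor (minpoly.not_isUnit ℝ φ) (minpoly.ne_zero hint)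
  have hq2 : q.natDegree ≤ 2 := hq.natDegree_le_two
  have hq1 : 0 < q.natDegree :=
    Polynomial.natDegree_pos_iff_degree_pos.mpr (Polynomial.degree_pos_of_irreducible hq)
  -- `ker q(φ) ≠ 0`, by minimality of the minimal polynomial
  have hker : ∃ v : 𝔤, v ≠ 0 ∧ Polynomial.aeval φ q v = 0 := by
    by_contra hcon
    push Not at hcon
    obtain ⟨r, hr⟩ := hqp
    have hq0 : q ≠ 0 := hq.ne_zero
    have hr0 : r ≠ 0 := by
      rintro rfl
      exact minpoly.ne_zero hint (by rw [hr, mul_zero])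
    have hinj : ∀ v : 𝔤, Polynomial.aeval φ q v = 0 → v = 0 := fun v hv => by
      by_contra hv0
      exact hcon v hv0 hv
    have haev : Polynomial.aeval φ r = 0 := by
      ext v
      have h := LinearMap.congr_fun (minpoly.aeval ℝ φ) v
      rw [hr, map_mul, Module.End.mul_apply, LinearMap.zero_apply] at h
      rw [LinearMap.zero_apply]
      exact hinj _ h
    have hdvd : minpoly ℝ φ ∣ r := minpoly.dvd ℝ φ haev
    have hle' := Polynomial.natDegree_le_of_dvd hdvd hr0
    have hmul : (minpoly ℝ φ).natDegree = q.natDegree + r.natDegree := by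
      rw [hr, Polynomial.natDegree_mul hq0 hr0]
    omega
  obtain ⟨v₀, hv₀, hv₀q⟩ := hker
  -- the explicit form of `q` and of `q(φ)`
  have hqexp : q = Polynomial.C (q.coeff 0) + Polynomial.C (q.coeff 1) * Polynomial.X +
      Polynomial.C (q.coeff 2) * Polynomial.X ^ 2 := by
    have h := Polynomial.as_sum_range_C_mul_X_pow' q (show q.natDegree < 3 by omega)
    conv_lhs => rw [h]
    simp [Finset.sum_range_succ]
  have haev : ∀ v : 𝔤, Polynomial.aeval φ q v = q.coeff 0 • v + q.coeff 1 • φ v + q.coeff 2 • φ (φ v) := by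
    intro v
    conv_lhs => rw [hqexp]
    simp only [map_add, map_mul, Polynomial.aeval_C, Polynomial.aeval_X, LinearMap.add_apply,
      Module.End.mul_apply, Module.algebraMap_end_apply, pow_two]
  -- `ker q(φ)` is an ideal, nonzero, hence everything: `q(φ) = 0`
  let I : LieIdeal ℝ 𝔤 :=
    { LinearMap.ker (Polynomial.aeval φ q : 𝔤 →ₗ[ℝ] 𝔤) with
      lie_mem := fun {x m} (hm : m ∈ LinearMap.ker (Polynomial.aeval φ q : 𝔤 →ₗ[ℝ] 𝔤)) =>
        show ⁅x, m⁆ ∈ LinearMap.ker (Polynomial.aeval φ q : 𝔤 →ₗ[ℝ] 𝔤) from by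
          have hm' : Polynomial.aeval φ q m = 0 := LinearMap.mem_ker.mp hm
          refine LinearMap.mem_ker.mpr ?_
          rw [haev] at hm' ⊢
          rw [hφ, hφ, ← lie_smul, ← lie_smul, ← lie_smul, ← lie_add, ← lie_add, hm', lie_zero] }
  have hzero : ∀ v : 𝔤, q.coeff 0 • v + q.coeff 1 • φ v + q.coeff 2 • φ (φ v) = 0 := by
    rcases LieAlgebra.IsSimple.eq_bot_or_eq_top I with h | h
    · exfalso
      have hb : LinearMap.ker (Polynomial.aeval φ q : 𝔤 →ₗ[ℝ] 𝔤) = ⊥ := (LieSubmodule.toSubmodule_eq_bot I).mpr h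
      have hmem : v₀ ∈ LinearMap.ker (Polynomial.aeval φ q : 𝔤 →ₗ[ℝ] 𝔤) := LinearMap.mem_ker.mpr hv₀q
      rw [hb] at hmem
      exact hv₀ ((Submodule.mem_bot ℝ).mp hmem)
    · intro v
      have hv : v ∈ I := by
        rw [h]
        exact LieSubmodule.mem_top v
      have hv' : Polynomial.aeval φ q v = 0 := LinearMap.mem_ker.mp hv
      rwa [haev] at hv'
  -- case analysis on the degree of `q`
  rcases Nat.lt_or_ge q.natDegree 2 with hd | hd
  · -- degree 1: `q₀ + q₁ φ = 0` with `q₁ ≠ 0`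
    have hd1 : q.natDegree = 1 := by omega
    have hq₂ : q.coeff 2 = 0 := Polynomial.coeff_eq_zero_of_natDegree_lt (by omega)
    have hq₁ : q.coeff 1 ≠ 0 := by
      have h := Polynomial.leadingCoeff_ne_zero.mpr hq.ne_zero
      rwa [Polynomial.leadingCoeff, hd1] at h
    refine ⟨-((q.coeff 1)⁻¹ * q.coeff 0), fun v => ?_⟩
    have h := hzero v
    rw [hq₂, zero_smul, add_zero] at h
    have h' : q.coeff 1 • φ v = -(q.coeff 0 • v) := eq_neg_of_add_eq_zero_right h
    calc φ v = (q.coeff 1)⁻¹ • (q.coeff 1 • φ v) := by rw [smul_smul, inv_mul_cancel₀ hq₁, one_smul]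
      _ = (q.coeff 1)⁻¹ • (-(q.coeff 0 • v)) := by rw [h']
      _ = (-((q.coeff 1)⁻¹ * q.coeff 0)) • v := by rw [smul_neg, smul_smul, neg_smul]
  · -- degree 2: impossible
    exfalso
    have hd2 : q.natDegree = 2 := by omega
    have hq₂ : q.coeff 2 ≠ 0 := by
      have h := Polynomial.leadingCoeff_ne_zero.mpr hq.ne_zero
      rwa [Polynomial.leadingCoeff, hd2] at h
    -- `q` has no real root: the discriminant is negative
    have hroots : q.roots = 0 :=
      (Polynomial.irreducible_iff_roots_eq_zero_of_degree_le_three (by omega) (by omega)).mp hq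
    have hdisc : discrim (q.coeff 2) (q.coeff 1) (q.coeff 0) < 0 := by
      by_contra hnn
      push Not at hnn
      obtain ⟨t, ht⟩ := exists_quadratic_eq_zero hq₂
        ⟨Real.sqrt (discrim (q.coeff 2) (q.coeff 1) (q.coeff 0)), (Real.mul_self_sqrt hnn).symm⟩
      have hroot : Polynomial.IsRoot q t := by
        rw [Polynomial.IsRoot.def, hqexp]
        simp only [Polynomial.eval_add, Polynomial.eval_mul, Polynomial.eval_C, Polynomial.eval_X,
          Polynomial.eval_pow]
        linear_combination ht
      have hmem : t ∈ q.roots := (Polynomial.mem_roots hq.ne_zero).mpr hroot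
      rw [hroots] at hmem
      simp at hmem
    -- `ψ = 2q₂ φ + q₁` is `κ`-symmetric and `ψ² = discrim`
    have hsym : ∀ a b : 𝔤, killingForm ℝ 𝔤 (φ a) b = killingForm ℝ 𝔤 a (φ b) := killing_apply_centroid φ hφ
    have hTsym : ∀ a b : 𝔤, killingForm ℝ 𝔤 ((2 * q.coeff 2) • φ a + q.coeff 1 • a) b =
        killingForm ℝ 𝔤 a ((2 * q.coeff 2) • φ b + q.coeff 1 • b) := by
      intro a b
      simp only [map_add, map_smul, LinearMap.add_apply, LinearMap.smul_apply, hsym, smul_eq_mul]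
    have hψ2 : ∀ v : 𝔤, (2 * q.coeff 2) • φ ((2 * q.coeff 2) • φ v + q.coeff 1 • v) +
        q.coeff 1 • ((2 * q.coeff 2) • φ v + q.coeff 1 • v) = discrim (q.coeff 2) (q.coeff 1) (q.coeff 0) • v := by
      intro v
      have h4 : (4 * q.coeff 2) • (q.coeff 0 • v + q.coeff 1 • φ v + q.coeff 2 • φ (φ v)) = 0 := by
        rw [hzero v, smul_zero]
      rw [map_add, map_smul, map_smul, discrim]
      calc (2 * q.coeff 2) • ((2 * q.coeff 2) • φ (φ v) + q.coeff 1 • φ v) +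
            q.coeff 1 • ((2 * q.coeff 2) • φ v + q.coeff 1 • v)
          = (4 * q.coeff 2) • (q.coeff 0 • v + q.coeff 1 • φ v + q.coeff 2 • φ (φ v)) +
              (q.coeff 1 ^ 2 - 4 * q.coeff 2 * q.coeff 0) • v := by module
        _ = (q.coeff 1 ^ 2 - 4 * q.coeff 2 * q.coeff 0) • v := by rw [h4, zero_add]
    have hκw : killingForm ℝ 𝔤 ((2 * q.coeff 2) • φ v₀ + q.coeff 1 • v₀) ((2 * q.coeff 2) • φ v₀ + q.coeff 1 • v₀) =
        discrim (q.coeff 2) (q.coeff 1) (q.coeff 0) * killingForm ℝ 𝔤 v₀ v₀ := by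
      rw [hTsym v₀ _, hψ2 v₀, map_smul, smul_eq_mul]
    have hpos : 0 < killingForm ℝ 𝔤 ((2 * q.coeff 2) • φ v₀ + q.coeff 1 • v₀)
        ((2 * q.coeff 2) • φ v₀ + q.coeff 1 • v₀) := by
      rw [hκw]
      exact mul_pos_of_neg_of_neg hdisc (hdef v₀ hv₀)
    exact absurd (hle _) (not_le.mpr hpos)

/-- Every invariant bilinear form on a simple real Lie algebra with negative definite Killing form (compact simple
`G`) is a multiple of the Killing form — print's sentence with «semisimple» read as «simple». [folklore]
(print: Balaban1987RG1, p.289 after (4.33)) -/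
theorem exists_eq_mul_killingForm_of_killing_neg {𝔤 : Type*} [LieRing 𝔤] [LieAlgebra ℝ 𝔤] [FiniteDimensional ℝ 𝔤]
    [LieAlgebra.IsSimple ℝ 𝔤] [LieAlgebra.IsKilling ℝ 𝔤] (hdef : ∀ x : 𝔤, x ≠ 0 → killingForm ℝ 𝔤 x x < 0)
    (Φ : LinearMap.BilinForm ℝ 𝔤) (hΦ : Φ.lieInvariant 𝔤) :
    ∃ c : ℝ, ∀ x y : 𝔤, Φ x y = c * killingForm ℝ 𝔤 x y :=
  exists_eq_mul_of_lieInvariant (killingForm ℝ 𝔤) Φ (LieModule.traceForm_lieInvariant ℝ 𝔤 𝔤)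
    (LieAlgebra.IsKilling.killingForm_nondegenerate ℝ 𝔤) (exists_eq_smul_of_centroid_of_killing_neg hdef) hΦ

end Centroid

/-! ## §3. Refutation under «semisimple» alone: product algebras [folklore] -/

section Product

variable {K : Type*} [Field K] {L₁ L₂ : Type*} [LieRing L₁] [LieAlgebra K L₁] [LieRing L₂] [LieAlgebra K L₂]

/-- On `𝔤₁ × 𝔤₂` the first projection `(x₁, x₂) ↦ (x₁, 0)` commutes with every `ad`. [folklore] -/
theorem fstProj_lie_comm (x y : L₁ × L₂) :
    ((LinearMap.inl K L₁ L₂) ∘ₗ (LinearMap.fst K L₁ L₂)) ⁅x, y⁆ =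
      ⁅x, ((LinearMap.inl K L₁ L₂) ∘ₗ (LinearMap.fst K L₁ L₂)) y⁆ := by
  simp [LieAlgebra.Prod.bracket_apply]

/-- **The centroid of a product of two NONZERO Lie algebras is not scalar** — the hypothesis `hcen` of §1 fails for
`𝔤 = 𝔤₁ × 𝔤₂`, e.g. `𝔰𝔲(2) ⊕ 𝔰𝔲(2)`, the Lie algebra of the compact semisimple `G = SU(2) × SU(2) ⊂ U(4)` admitted
by print's pp. 251–252 / p. 259 «semisimple compact Lie group G ⊂ U(N)». [folklore] (print: Balaban1987RG1, pp.251-252,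
p.259, p.289 after (4.33)) -/
theorem not_exists_fstProj_eq_smul [Nontrivial L₁] [Nontrivial L₂] :
    ¬ ∃ c : K, ∀ x : L₁ × L₂, ((LinearMap.inl K L₁ L₂) ∘ₗ (LinearMap.fst K L₁ L₂)) x = c • x := by
  rintro ⟨c, hc⟩
  obtain ⟨a, ha⟩ := exists_ne (0 : L₁)
  obtain ⟨b, hb⟩ := exists_ne (0 : L₂)
  have h1 : ((LinearMap.inl K L₁ L₂) ∘ₗ (LinearMap.fst K L₁ L₂)) (a, 0) = (a, 0) := by simp
  have h2 : ((LinearMap.inl K L₁ L₂) ∘ₗ (LinearMap.fst K L₁ L₂)) (0, b) = 0 := by simp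
  rw [hc] at h1 h2
  have hc0 : c = 0 := by
    rcases smul_eq_zero.mp h2 with h | h
    · exact h
    · exact absurd (Prod.mk_eq_zero.mp h).2 hb
  rw [hc0, zero_smul] at h1
  exact ha (Prod.mk_eq_zero.mp h1.symm).1

/-- The pullback `Φ((x₁,x₂),(y₁,y₂)) = Φ₁(x₁,y₁)` to `𝔤₁ × 𝔤₂` of an invariant form of `𝔤₁` is invariant — print's
(4.33) holds for it. [folklore] -/
theorem pullbackFst_lieInvariant (Φ₁ : LinearMap.BilinForm K L₁) (hΦ₁ : Φ₁.lieInvariant L₁) :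
    LinearMap.BilinForm.lieInvariant (L₁ × L₂) (Φ₁.compl₁₂ (LinearMap.fst K L₁ L₂) (LinearMap.fst K L₁ L₂)) := by
  intro x y z
  simp only [LinearMap.compl₁₂_apply, LinearMap.fst_apply, LieAlgebra.Prod.bracket_apply]
  exact hΦ₁ x.1 y.1 z.1

/-- … and nonzero if `Φ₁` is. [folklore] -/
theorem pullbackFst_ne_zero (Φ₁ : LinearMap.BilinForm K L₁) (h₁ : Φ₁ ≠ 0) :
    Φ₁.compl₁₂ (LinearMap.fst K L₁ L₂) (LinearMap.fst K L₁ L₂) ≠ 0 := by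
  intro h
  apply h₁
  ext a b
  have hab := LinearMap.congr_fun₂ h (a, 0) (b, 0)
  simpa using hab

/-- **Print's p. 289 conclusion «𝐄_ab = 𝐄δ_ab» FAILS under «G is semisimple» alone**: as soon as `𝔤₂ ≠ 0`, the
invariant nonzero form `Φ((x₁,x₂),(y₁,y₂)) = Φ₁(x₁,y₁)` on `𝔤₁ × 𝔤₂` is NOT `c·β` for ANY nondegenerate form `β`
(invariant or not; e.g. `tr AB` on `𝔰𝔲(2) ⊕ 𝔰𝔲(2) ⊂ 𝔲(4)`, or the Killing form) — in coordinates `𝐄_ab` is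
block-scalar, not scalar.  Compare `exists_eq_mul_of_lieInvariant`: hence the scalar-centroid hypothesis fails there
(directly: `not_exists_fstProj_eq_smul`). [folklore] (print: Balaban1987RG1, pp.251-252, p.259, p.289 after
(4.33)) -/
theorem not_exists_pullbackFst_eq_mul [Nontrivial L₂] (Φ₁ : LinearMap.BilinForm K L₁) (h₁ : Φ₁ ≠ 0)
    (β : LinearMap.BilinForm K (L₁ × L₂)) (hβn : β.Nondegenerate) :
    ¬ ∃ c : K, ∀ x y : L₁ × L₂,
      (Φ₁.compl₁₂ (LinearMap.fst K L₁ L₂) (LinearMap.fst K L₁ L₂)) x y = c * β x y := by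
  rintro ⟨c, hc⟩
  rcases eq_or_ne c 0 with rfl | hc0
  · apply pullbackFst_ne_zero (L₂ := L₂) Φ₁ h₁
    refine LinearMap.ext (fun x => LinearMap.ext (fun y => ?_))
    rw [hc, zero_mul, LinearMap.zero_apply, LinearMap.zero_apply]
  · obtain ⟨b, hb⟩ := exists_ne (0 : L₂)
    have hx : ((0 : L₁), b) = 0 := by
      refine hβn.1 _ (fun y => ?_)
      have h := hc (0, b) y
      simp only [LinearMap.compl₁₂_apply, LinearMap.fst_apply, map_zero, LinearMap.zero_apply] at h
      exact (mul_eq_zero.mp h.symm).resolve_left hc0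
    exact hb (Prod.mk_eq_zero.mp hx).2

end Product

/-! ## §4. The lineage's typing: the Hessian of `B ↦ 𝐄(exp iρB)` at `0` is a SCALAR kernel times `β` -/

section Lineage

variable {𝔄 : Type*} [NormedRing 𝔄] [NormedAlgebra ℝ 𝔄] [CompleteSpace 𝔄] {Λ T : Type*} [Fintype Λ] [Fintype T]
  [AddCommGroup T] {V : Type*} [NormedAddCommGroup V] [NormedSpace ℝ V] {F : Type*} [NormedAddCommGroup F]
  [NormedSpace ℝ F]

omit [AddCommGroup T] in
/-- The Hessian of the chart functional `f(B) = 𝐄(exp ρB)` at `0` is symmetric (`𝐄` `C³`, indeed `C²`, at `1`).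
[folklore] -/
theorem hessian_chart_symm {ℰ : (Λ → T → 𝔄) → F} (ρ : V →L[ℝ] 𝔄) (hℰ : ContDiffAt ℝ 3 ℰ 1) (u w : Λ → T → V) :
    fderiv ℝ (fderiv ℝ (fun B : Λ → T → V => ℰ (fun ν x => exp (ρ (B ν x))))) 0 u w =
      fderiv ℝ (fderiv ℝ (fun B : Λ → T → V => ℰ (fun ν x => exp (ρ (B ν x))))) 0 w u := by
  set Φ : (Λ → T → V) → Λ → T → 𝔄 := fun B ν x => exp (ρ (B ν x)) with hΦ
  show fderiv ℝ (fderiv ℝ (fun B : Λ → T → V => ℰ (Φ B))) 0 u w = fderiv ℝ (fderiv ℝ (fun B => ℰ (Φ B))) 0 w u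
  have hC : ContDiff ℝ 3 Φ := contDiff_chart ρ
  have hΦ0 : Φ 0 = 1 := chart_zero ρ
  have hℰ' : ContDiffAt ℝ 3 ℰ (Φ 0) := by
    rw [hΦ0]
    exact hℰ
  have hf : ContDiffAt ℝ 2 (fun B : Λ → T → V => ℰ (Φ B)) 0 := (hℰ'.comp 0 hC.contDiffAt).of_le (by norm_num)
  exact hf.isSymmSndFDerivAt (by simp) u w

variable [DecidableEq Λ] [DecidableEq T] {𝔤 : Type*} [LieRing 𝔤] [LieAlgebra ℝ 𝔤] [FiniteDimensional ℝ 𝔤]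

/-- **Each bond-pair entry of the Hessian is an invariant bilinear map** (print: 𝐄^{(2)}_{μ,ν}(x, y) ∈ 𝔤⊗𝔤 satisfies
the infinitesimal (4.33)): for `G` semisimple, `𝐄` `C³` at `1` and gauge invariant (4.7), `D²f(0)(δ_{μ,x}[l, a],
δ_{ν,y}b) = −D²f(0)(δ_{μ,x}a, δ_{ν,y}[l, b])` — the parent's `hessian_chart_ad_invariant_of_isSemisimple` on one-bond
fields plus the symmetry of `D²f(0)`. [cite: Balaban1987RG1, (4.32)-(4.33) p.289] -/
theorem hessian_chart_single_lieInvariant [LieAlgebra.IsSemisimple ℝ 𝔤] (eV : V ≃ₗ[ℝ] 𝔤)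
    {ℰ : (Λ → T → 𝔄) → F} (e : Λ → T) (ρ : V →L[ℝ] 𝔄)
    (hρ : ∀ a b : V, ρ (eV.symm ⁅eV a, eV b⁆) = ρ a * ρ b - ρ b * ρ a) (hℰ : ContDiffAt ℝ 3 ℰ 1)
    (h47 : ∀ lam : T → V, ∀ᶠ W in 𝓝 (1 : Λ → T → 𝔄), ∀ᶠ t in 𝓝 (0 : ℝ),
      ℰ (fun ν x => exp (t • ρ (lam x)) * W ν x * exp (-(t • ρ (lam (x + e ν))))) = ℰ W)
    (μ : Λ) (x : T) (ν : Λ) (y : T) (l a b : 𝔤) :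
    fderiv ℝ (fderiv ℝ (fun B : Λ → T → V => ℰ (fun ν x => exp (ρ (B ν x))))) 0
        (Pi.single μ (Pi.single x (eV.symm ⁅l, a⁆))) (Pi.single ν (Pi.single y (eV.symm b))) =
      - fderiv ℝ (fderiv ℝ (fun B : Λ → T → V => ℰ (fun ν x => exp (ρ (B ν x))))) 0
        (Pi.single μ (Pi.single x (eV.symm a))) (Pi.single ν (Pi.single y (eV.symm ⁅l, b⁆))) := by
  have h := hessian_chart_ad_invariant_of_isSemisimple eV e ρ hρ hℰ h47 (eV.symm l)
    (Pi.single μ (Pi.single x (eV.symm a))) (Pi.single ν (Pi.single y (eV.symm b)))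
  -- brackets of one-bond fields are one-bond fields
  have hsingle : ∀ (κ' : Λ) (z : T) (c : 𝔤),
      (fun ν' x' => eV.symm ⁅eV (eV.symm l), eV ((Pi.single κ' (Pi.single z (eV.symm c)) : Λ → T → V) ν' x')⁆)
        = Pi.single κ' (Pi.single z (eV.symm ⁅l, c⁆)) := by
    intro κ' z c
    funext ν' x'
    by_cases hν : ν' = κ'
    · subst hν
      by_cases hx : x' = z
      · subst hx
        simp
      · simp [hx]
    · simp [hν]
  rw [hsingle ν y b, hsingle μ x a, hessian_chart_symm ρ hℰ (Pi.single ν (Pi.single y (eV.symm b)))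
    (Pi.single μ (Pi.single x (eV.symm ⁅l, a⁆)))] at h
  rw [eq_neg_iff_add_eq_zero, add_comm]
  exact h

/-- **(4.34), line 1 — «(4.6) = Σ_{(x,μ),(y,ν)} 𝐄^{(2)}_{μ,ν}(X, x, y) tr δB_μ(x)B_ν(y) + …», i.e. «⟨𝐄, A⊗B⟩ = 𝐄 tr AB»
for the Hessian, UNDER SCALAR CENTROID**: for `G` semisimple (print) AND `𝔤` with scalar centroid (`hcen`, the named
extra hypothesis = `G` simple; §2, §3), `𝐄` `C³` at `1` and gauge invariant (4.7), and `β` any nondegenerate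
invariant form on `𝔤` (print's `tr AB`), there is a SCALAR kernel `E : Λ → T → Λ → T → F` with
`D²f(0)(u, v) = Σ_{μ,x,ν,y} β(u_μ(x), v_ν(y)) • E_{μ,ν}(x, y)` for all `𝔤`-valued fields `u`, `v`
(`f(B) = 𝐄(exp ρB)`, charges read in `𝔤` through `eV`). [cite: Balaban1987RG1, (4.32)-(4.34) p.289] -/
theorem hessian_chart_eq_sum_scalar_kernel [LieAlgebra.IsSemisimple ℝ 𝔤] (eV : V ≃ₗ[ℝ] 𝔤)
    {ℰ : (Λ → T → 𝔄) → F} (e : Λ → T) (ρ : V →L[ℝ] 𝔄)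
    (hρ : ∀ a b : V, ρ (eV.symm ⁅eV a, eV b⁆) = ρ a * ρ b - ρ b * ρ a) (hℰ : ContDiffAt ℝ 3 ℰ 1)
    (h47 : ∀ lam : T → V, ∀ᶠ W in 𝓝 (1 : Λ → T → 𝔄), ∀ᶠ t in 𝓝 (0 : ℝ),
      ℰ (fun ν x => exp (t • ρ (lam x)) * W ν x * exp (-(t • ρ (lam (x + e ν))))) = ℰ W)
    (β : LinearMap.BilinForm ℝ 𝔤) (hβ : β.lieInvariant 𝔤) (hβn : β.Nondegenerate)
    (hcen : ∀ φ : 𝔤 →ₗ[ℝ] 𝔤, (∀ x y : 𝔤, φ ⁅x, y⁆ = ⁅x, φ y⁆) → ∃ c : ℝ, ∀ x, φ x = c • x) :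
    ∃ E : Λ → T → Λ → T → F, ∀ u v : Λ → T → V,
      fderiv ℝ (fderiv ℝ (fun B : Λ → T → V => ℰ (fun ν x => exp (ρ (B ν x))))) 0 u v =
        ∑ μ, ∑ x, ∑ ν, ∑ y, β (eV (u μ x)) (eV (v ν y)) • E μ x ν y := by
  set H := fderiv ℝ (fderiv ℝ (fun B : Λ → T → V => ℰ (fun ν x => exp (ρ (B ν x))))) 0 with hH
  -- the one-bond embeddings `a ↦ δ_{μ,x} a` and the bond-pair entries of `H` as bilinear maps on `𝔤`
  let S : Λ → T → 𝔤 →ₗ[ℝ] (Λ → T → V) := fun μ x =>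
    (LinearMap.single ℝ (fun _ : Λ => T → V) μ) ∘ₗ (LinearMap.single ℝ (fun _ : T => V) x) ∘ₗ eV.symm.toLinearMap
  let Hb : Λ → T → Λ → T → 𝔤 →ₗ[ℝ] 𝔤 →ₗ[ℝ] F := fun μ x ν y =>
    (((ContinuousLinearMap.coeLM ℝ).comp (H : (Λ → T → V) →ₗ[ℝ] ((Λ → T → V) →L[ℝ] F))).compl₁₂ (S μ x) (S ν y))
  have hHb : ∀ μ x ν y (a b : 𝔤), Hb μ x ν y a b =
      H (Pi.single μ (Pi.single x (eV.symm a))) (Pi.single ν (Pi.single y (eV.symm b))) := by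
    intro μ x ν y a b
    rfl
  have hinv : ∀ μ x ν y (l a b : 𝔤), Hb μ x ν y ⁅l, a⁆ b = -Hb μ x ν y a ⁅l, b⁆ := by
    intro μ x ν y l a b
    rw [hHb, hHb]
    exact hessian_chart_single_lieInvariant eV e ρ hρ hℰ h47 μ x ν y l a b
  have hE : ∀ μ x ν y, ∃ c : F, ∀ a b : 𝔤, Hb μ x ν y a b = β a b • c := fun μ x ν y =>
    exists_eq_smul_of_lieInvariant₂ β hβ hβn hcen (Hb μ x ν y) (hinv μ x ν y)
  choose E hE' using hE
  refine ⟨E, fun u v => ?_⟩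
  -- expand both fields over one-bond fields
  have hsum : ∀ w : Λ → T → V, ∑ μ, ∑ x, (Pi.single μ (Pi.single x (w μ x)) : Λ → T → V) = w := by
    intro w
    have h1 : ∀ μ, ∑ x, (Pi.single μ (Pi.single x (w μ x)) : Λ → T → V) = Pi.single μ (w μ) := by
      intro μ
      have h := (map_sum (AddMonoidHom.single (fun _ : Λ => T → V) μ)
        (fun x => (Pi.single x (w μ x) : T → V)) Finset.univ).symm
      simp only [AddMonoidHom.single_apply, Finset.univ_sum_single] at h
      exact h
    simp_rw [h1]
    exact Finset.univ_sum_single w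
  have hexp1 : ∀ (G : (Λ → T → V) →L[ℝ] F) (w : Λ → T → V),
      G w = ∑ ν, ∑ y, G (Pi.single ν (Pi.single y (w ν y))) := by
    intro G w
    conv_lhs => rw [← hsum w]
    simp only [map_sum]
  have hu : H u v = ∑ μ, ∑ x, H (Pi.single μ (Pi.single x (u μ x))) v := by
    rw [← ContinuousLinearMap.flip_apply H]
    conv_lhs => rw [← hsum u]
    simp only [map_sum]
    simp only [ContinuousLinearMap.flip_apply]
  have hexp : H u v = ∑ μ, ∑ x, ∑ ν, ∑ y,
      H (Pi.single μ (Pi.single x (u μ x))) (Pi.single ν (Pi.single y (v ν y))) := by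
    rw [hu]
    refine Finset.sum_congr rfl (fun μ _ => Finset.sum_congr rfl (fun x _ => ?_))
    exact hexp1 _ v
  rw [hexp]
  refine Finset.sum_congr rfl (fun μ _ => Finset.sum_congr rfl (fun x _ =>
    Finset.sum_congr rfl (fun ν _ => Finset.sum_congr rfl (fun y _ => ?_))))
  have h := hE' μ x ν y (eV (u μ x)) (eV (v ν y))
  rw [hHb, LinearEquiv.symm_apply_apply, LinearEquiv.symm_apply_apply] at h
  exact h

/-- `hessian_chart_eq_sum_scalar_kernel` with `β` the Killing form (`G` semisimple ⇔ `κ` nondegenerate in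
characteristic zero: Mathlib's `LieAlgebra.IsKilling`, which supplies `IsSemisimple`), under scalar centroid.
[cite: Balaban1987RG1, (4.32)-(4.34) p.289] -/
theorem hessian_chart_eq_sum_scalar_kernel_killing [LieAlgebra.IsKilling ℝ 𝔤] (eV : V ≃ₗ[ℝ] 𝔤)
    {ℰ : (Λ → T → 𝔄) → F} (e : Λ → T) (ρ : V →L[ℝ] 𝔄)
    (hρ : ∀ a b : V, ρ (eV.symm ⁅eV a, eV b⁆) = ρ a * ρ b - ρ b * ρ a) (hℰ : ContDiffAt ℝ 3 ℰ 1)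
    (h47 : ∀ lam : T → V, ∀ᶠ W in 𝓝 (1 : Λ → T → 𝔄), ∀ᶠ t in 𝓝 (0 : ℝ),
      ℰ (fun ν x => exp (t • ρ (lam x)) * W ν x * exp (-(t • ρ (lam (x + e ν))))) = ℰ W)
    (hcen : ∀ φ : 𝔤 →ₗ[ℝ] 𝔤, (∀ x y : 𝔤, φ ⁅x, y⁆ = ⁅x, φ y⁆) → ∃ c : ℝ, ∀ x, φ x = c • x) :
    ∃ E : Λ → T → Λ → T → F, ∀ u v : Λ → T → V,
      fderiv ℝ (fderiv ℝ (fun B : Λ → T → V => ℰ (fun ν x => exp (ρ (B ν x))))) 0 u v =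
        ∑ μ, ∑ x, ∑ ν, ∑ y, killingForm ℝ 𝔤 (eV (u μ x)) (eV (v ν y)) • E μ x ν y :=
  hessian_chart_eq_sum_scalar_kernel eV e ρ hρ hℰ h47 (killingForm ℝ 𝔤) (LieModule.traceForm_lieInvariant ℝ 𝔤 𝔤)
    (LieAlgebra.IsKilling.killingForm_nondegenerate ℝ 𝔤) hcen

end Lineage

end Literature.MathematicalPhysics.QuantumFieldTheory.Balaban1983to89.B12Schur433
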